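import Mathlib
import HarnessLib
import Summits.Ventures.LatticeQCDFlow.Exactness.SphereNLOFlowAction

/-!
# The next-to-leading-order flow action, explicit coefficients; the `d = 3` (2D O(3) model) case reproduces the printed first-order functional of Chamness–Kovner–Orginos

HONEST FRAMING: exact (Metropolis-corrected) sampling algorithms for lattice gauge theory;
figures of merit are autocorrelation/cost numbers at stated couplings and volumes; no
continuum-physics claim.

Venture `LatticeQCDFlow` (cell pub-lqcd), topic `Exactness`; FANOUT row 7 (`s0-cpn-null`).  NEW WORK
of the cell over the tree's `SphereNLOFlowAction.lean` (`nloFlowAction`, `nloPotential`,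
`stapleSum A`, `crossSum B`, `squareSum C`); nothing is cited as a fact.  LITERATURE ANCHOR, NAMED
ONLY (found after `SphereNLOFlowAction.lean` was written; recorded here so that the tree carries it):
C. Chamness, D. Kovner, K. Orginos, "Trivializing Flow in 2D O(3) sigma model", PoS(LATTICE2023) 008,
arXiv:2401.06860, §4.1 — for the 2D O(3) model (`d = 3`, unit couplings on the square lattice,
action `𝒮 = (β/2) Σ_x Σ_μ (1 − s_x·s_{x+μ})`, `μ` over the four unit vectors) they solve the same
order-by-order equations (their eq. after (4.1): `−∂²S⁽ⁿ⁾ + Σ_x ∂_x𝒮·∂_x S⁽ⁿ⁻¹⁾ = −Ċ⁽ⁿ⁾`, with the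
opposite overall sign convention `−∂²S⁽⁰⁾ = −𝒮 − Ċ⁽⁰⁾`, so their `S⁽ⁿ⁾` is our `−S̃⁽ⁿ⁾`) and print
`S⁽¹⁾ = (β²/40) [2Ψ⁽²⁾ − Ψ̃⁽¹'¹⁾ + (1/6) Ψ⁽¹'¹ᶠ⁾]` with `Ψ⁽²⁾ = Σ_x Σ_{μ,ν} s_x·s_{x+μ+ν}`,
`Ψ̃⁽¹'¹⁾ = Σ_x Σ_{μ,ν} (s_x·s_{x+μ})(s_x·s_{x+ν})`, `Ψ⁽¹'¹ᶠ⁾ = Σ_x Σ_μ (s_x·s_{x+μ})²` (orders 2 and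
beyond also printed there).  DICTIONARY (U = identity on the four neighbours, `κ = β/2`,
configurations on the unit spheres): `A = Ψ⁽²⁾ − 4V` (the `ν = −μ` terms are constants),
`B = Ψ̃⁽¹'¹⁾ − Ψ⁽¹'¹ᶠ⁾` (`B` excludes `μ = ν`), `C = Ψ⁽¹'¹ᶠ⁾`.

## Content

* **`nloFlowAction_eq`** — the coefficients spelled out for `d ≥ 2`:
  `S̃⁽¹⁾ = −(2κ²/((d−1)(2d−1))) A + (κ²/((d−1)(2d−1))) B + (κ²/(2d(d−1))) C`.
* **`nloFlowAction_finrank_three`** — `d = 3`: `S̃⁽¹⁾ = −(κ²/5) A + (κ²/10) B + (κ²/12) C`, and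
  **`nloFlowAction_finrank_three_cko`** — the same regrouped as
  `S̃⁽¹⁾ = −(κ²/10) [2A − (B + C) + (1/6) C]`: with `κ = β/2` and the dictionary this is
  `−(β²/40) [2Ψ⁽²⁾ − Ψ̃⁽¹'¹⁾ + (1/6)Ψ⁽¹'¹ᶠ⁾]` up to an additive constant, i.e. MINUS the printed
  `S⁽¹⁾` of Chamness–Kovner–Orginos — agreement, given their opposite sign convention.  So the
  general-`d`, general-transporter formula certified in `SphereNLOFlowAction.nlo_equation`
  reproduces the one printed first-order result we know of (O(3), unit couplings) and extends it to
  the gauged CP(N−1) class (`d = 2N`, U(1) link transporters, any loop-free graph).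

NOT CLAIMED: that the general-`d` / transporter form is absent from the literature beyond the
searches recorded in the cell's notes; orders `≥ 2` (printed for O(3) by Chamness–Kovner–Orginos,
not typed); anything quantitative.
-/

noncomputable section

namespace Summit.Ventures.LatticeQCDFlow.Exactness

open scoped RealInnerProductSpace

variable {E : Type*} [NormedAddCommGroup E] [InnerProductSpace ℝ E]
variable {Λ : Type*} [Fintype Λ] [DecidableEq Λ]

/-- **The NLO flow action with its coefficients spelled out** (`d = dim E ≥ 2`):
`S̃⁽¹⁾ = −(2κ²/((d−1)(2d−1))) A + (κ²/((d−1)(2d−1))) B + (κ²/(2d(d−1))) C`. -/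
theorem nloFlowAction_eq (hd : 2 ≤ Module.finrank ℝ E) (κ : ℝ) (U : Λ → Λ → (E →L[ℝ] E))
    (x : Λ → E) :
    nloFlowAction κ U x =
      -(2 * κ ^ 2 / (((Module.finrank ℝ E : ℝ) - 1) * (2 * (Module.finrank ℝ E : ℝ) - 1))) *
          stapleSum U x +
        κ ^ 2 / (((Module.finrank ℝ E : ℝ) - 1) * (2 * (Module.finrank ℝ E : ℝ) - 1)) *
          crossSum U x +
        κ ^ 2 / (2 * (Module.finrank ℝ E : ℝ) * ((Module.finrank ℝ E : ℝ) - 1)) * squareSum U x := by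
  have hd' : (2 : ℝ) ≤ Module.finrank ℝ E := by exact_mod_cast hd
  have h1 : ((Module.finrank ℝ E : ℝ) - 1) ≠ 0 := by intro h; linarith
  have h2 : (2 * (Module.finrank ℝ E : ℝ) - 1) ≠ 0 := by intro h; linarith
  have h3 : (Module.finrank ℝ E : ℝ) ≠ 0 := by intro h; linarith
  unfold nloFlowAction nloPotential
  field_simp
  ring

/-- **`d = 3` (the 2D O(3) model's site sphere `S²`)**:
`S̃⁽¹⁾ = −(κ²/5) A + (κ²/10) B + (κ²/12) C`. -/
theorem nloFlowAction_finrank_three (h3 : Module.finrank ℝ E = 3) (κ : ℝ)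
    (U : Λ → Λ → (E →L[ℝ] E)) (x : Λ → E) :
    nloFlowAction κ U x =
      -(κ ^ 2 / 5) * stapleSum U x + κ ^ 2 / 10 * crossSum U x + κ ^ 2 / 12 * squareSum U x := by
  rw [nloFlowAction_eq (by omega) κ U x, h3]
  push_cast
  ring

/-- **Agreement with the printed O(3) first-order functional** (Chamness–Kovner–Orginos, PoS
LATTICE2023 008, §4.1), in our variables: for `d = 3`,
`S̃⁽¹⁾ = −(κ²/10) [2A − (B + C) + (1/6) C]`; with `κ = β/2`, `A = Ψ⁽²⁾ − 4V`, `B + C = Ψ̃⁽¹'¹⁾`,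
`C = Ψ⁽¹'¹ᶠ⁾` this is `−(β²/40)[2Ψ⁽²⁾ − Ψ̃⁽¹'¹⁾ + Ψ⁽¹'¹ᶠ⁾/6]` up to a constant — minus their
`S⁽¹⁾`, as it must be under their opposite sign convention for the flow functional. -/
theorem nloFlowAction_finrank_three_cko (h3 : Module.finrank ℝ E = 3) (κ : ℝ)
    (U : Λ → Λ → (E →L[ℝ] E)) (x : Λ → E) :
    nloFlowAction κ U x =
      -(κ ^ 2 / 10) * (2 * stapleSum U x - (crossSum U x + squareSum U x) +
        (1 / 6) * squareSum U x) := by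
  rw [nloFlowAction_finrank_three h3]
  ring

/-- The same with the O(3) normalisation `κ = β/2` made explicit:
`S̃⁽¹⁾ = −(β²/40) [2A − (B + C) + (1/6) C]`. -/
theorem nloFlowAction_finrank_three_beta (h3 : Module.finrank ℝ E = 3) (β : ℝ)
    (U : Λ → Λ → (E →L[ℝ] E)) (x : Λ → E) :
    nloFlowAction (β / 2) U x =
      -(β ^ 2 / 40) * (2 * stapleSum U x - (crossSum U x + squareSum U x) +
        (1 / 6) * squareSum U x) := by
  rw [nloFlowAction_finrank_three_cko h3]
  ring

end Summit.Ventures.LatticeQCDFlow.Exactness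

end
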